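import Mathlib.FieldTheory.IsAlgClosed.AlgebraicClosure
import Mathlib.FieldTheory.IntermediateField.Adjoin.Basic
import Literature.Computability.AlgebraicComplexity.AsymptoticRankScalarExtension
import Literature.Computability.AlgebraicComplexity.MatMulRankLowerBoundsBlaserProofs
import HarnessLib

/-!
# Asymptotic rank and the exponent `ω` under field extension (BCS §15.3)

Topic `Literature/Computability/AlgebraicComplexity`. Companion of
`AsymptoticRankScalarExtension.lean` (which treats the transcendental extension `ℂ/ℚ` via the
Nullstellensatz): here the extension `L/K` is ALGEBRAIC (in particular `L = K̄`, the algebraic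
closure), which is what the reduction "we may assume `𝔽` is algebraically closed" of
Alman–Li 2026, Cor. 4.1 (`AlmanLi2026ThreeByThreeProofs.lean`) needs. Everything here is proved;
no definitions, no named facts.

* `asymptoticRank_map_le` — along any ring homomorphism `f : K → L`, `R̃_L(f ∘ t) ≤ R̃_K(t)`
  (termwise `R_L ≤ R_K`, `tensorRank_map_le`).
* `admissibleExponents_subset_of_ringHom`, `omega_le_omega_of_ringHom` — `ω(L) ≤ ω(K)`
  (Bürgisser–Clausen–Shokrollahi 1997, (15.14): "`k ⊆ K ⇒ ω(K) ≤ ω(k)`"; the matrix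
  multiplication tensor has entries `0, 1`).
* `exists_finiteDimensional_decomposition` — a decomposition of `t_L` into `r` triads over an
  algebraic extension `L/K` has its coordinates in a FINITE subextension `E/K`
  (`IntermediateField.adjoin` of the finitely many coordinates), over which `t_E` is then a sum of
  `r` triads. This replaces the Nullstellensatz step of BCS Prop. (15.17) in the algebraic case.
* `exists_tensorRank_kroneckerPow_lt_of_isAlgebraic`, `asymptoticRank_algebraMap_of_isAlgebraic`
  — the limit argument of BCS Cor. (15.18) exactly as in `AsymptoticRankScalarExtension`:
  `R_K(t^{⊗ m₀ j}) ≤ d³ · R_E(t_E^{⊗ m₀})^j` (`tensorRank_le_of_eq_sum_algebraMap`, `d = [E : K]`)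
  and `d^{3/(m₀ j)} → 1`, whence **`R̃_K(t) = R̃_L(t_L)` for every algebraic extension `L/K`**
  (BCS Prop. (15.17)(1)/Cor. (15.18) for `R̃` of a tensor in place of `ω`; Alman–Li 2026, proof of
  Cor. 4.1: "asymptotic rank is invariant under field extension [BCS]").

## References

* [BurgisserClausenShokrollahi1997] P. Bürgisser, M. Clausen, M. A. Shokrollahi, *Algebraic
  Complexity Theory*, Grundlehren 315, Springer 1997 — §15.3, (15.14)–(15.15), Prop. (15.17),
  Cor. (15.18).
* [AlmanLi2026] J. Alman, B. Li, *Asymptotic Rank Speedup Theorems, Revisited*,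
  arXiv:2605.21738 (2026), proof of Cor. 4.1.
-/

noncomputable section

open scoped BigOperators

namespace Literature.Computability.AlgebraicComplexity

universe u v

/-! ## The easy direction: extension of scalars does not increase `R̃` or `ω` -/

section Easy

variable {K : Type u} {L : Type v} [Field K] [Field L]
variable {ι κ μ : Type*}

/-- Scalar extension along a ring homomorphism commutes with Kronecker powers. [folklore] -/
theorem kroneckerPow_map (f : K →+* L) (t : ι → κ → μ → K) (m : ℕ) :
    kroneckerPow (fun a b c => f (t a b c)) m = fun a b c => f (kroneckerPow t m a b c) := by
  funext a b c
  simp only [kroneckerPow_apply, map_prod]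

variable [Fintype ι] [Fintype κ] [Fintype μ]

/-- **`R̃_L(f ∘ t) ≤ R̃_K(t)`** along any ring homomorphism `f : K → L` (in particular for a field
extension `L ⊇ K`): termwise `R_L((f ∘ t)^{⊗N}) = R_L(f ∘ t^{⊗N}) ≤ R_K(t^{⊗N})`
(BCS (15.14) for tensors). [cite: BurgisserClausenShokrollahi1997, §15.3 (15.14)] -/
theorem asymptoticRank_map_le (f : K →+* L) (t : ι → κ → μ → K) :
    asymptoticRank (fun a b c => f (t a b c)) ≤ asymptoticRank t := by
  unfold asymptoticRank
  have hbdd : BddBelow (Set.range fun N : ℕ =>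
      ((tensorRank (kroneckerPow (fun a b c => f (t a b c)) (N + 1)) : ℝ) ^ ((N : ℝ) + 1)⁻¹)) :=
    ⟨0, by rintro _ ⟨N, rfl⟩; positivity⟩
  refine le_ciInf fun N => (ciInf_le hbdd N).trans ?_
  have hle : (tensorRank (kroneckerPow (fun a b c => f (t a b c)) (N + 1)) : ℝ) ≤
      tensorRank (kroneckerPow t (N + 1)) := by
    rw [kroneckerPow_map]
    exact_mod_cast tensorRank_map_le f (kroneckerPow t (N + 1))
  exact Real.rpow_le_rpow (Nat.cast_nonneg _) hle (by positivity)

omit [Fintype ι] [Fintype κ] [Fintype μ] in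
/-- Admissible exponents transfer to extensions: `R_L(⟨n,n,n⟩) ≤ R_K(⟨n,n,n⟩)` for all `n`
(BCS (15.14): "`k ⊆ K ⇒ ω(K) ≤ ω(k)`"). [cite: BurgisserClausenShokrollahi1997, §15.3 (15.14)] -/
theorem admissibleExponents_subset_of_ringHom (f : K →+* L) :
    admissibleExponents K ⊆ admissibleExponents L := fun _ hβ =>
  (Asymptotics.isBigO_of_le Filter.atTop fun n => by
      rw [Real.norm_natCast, Real.norm_natCast]
      exact_mod_cast tensorRank_matMulTensor_map_le f n n n).trans hβ

omit [Fintype ι] [Fintype κ] [Fintype μ] in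
/-- **`ω(L) ≤ ω(K)` for a field extension `L ⊇ K`** (along any ring homomorphism `K → L`;
BCS (15.14)). [cite: BurgisserClausenShokrollahi1997, §15.3 (15.14)] -/
theorem omega_le_omega_of_ringHom (f : K →+* L) : omega L ≤ omega K :=
  csInf_le_csInf (admissibleExponents_bddBelow L) (admissibleExponents_nonempty K)
    (admissibleExponents_subset_of_ringHom f)

end Easy

/-! ## Algebraic extensions: descent to a finite subextension and the limit argument -/

section Algebraic

variable {K : Type u} {L : Type v} [Field K] [Field L] [Algebra K L] [Algebra.IsAlgebraic K L]
variable {ι κ μ : Type*} [Fintype ι] [Fintype κ] [Fintype μ]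

/-- **Descent of a decomposition to a finite subextension** (the algebraic case of the first step
of BCS Prop. (15.17): "we may assume that `A` is a finitely generated `k`-algebra …"): if the
scalar extension `x_L` of a tensor `x` over `K` to an ALGEBRAIC extension `L` is a sum of `r`
triads, then all coordinates lie in the intermediate field `E` they generate, which is finite over
`K`, and `x_E` is a sum of `r` triads over `E`. [cite: BurgisserClausenShokrollahi1997, Prop. 15.17] -/
theorem exists_finiteDimensional_decomposition (x : ι → κ → μ → K) {r : ℕ} (w : Fin r → ι → L)
    (u : Fin r → κ → L) (v : Fin r → μ → L)
    (h : (fun a b c => algebraMap K L (x a b c)) = ∑ i, triad (w i) (u i) (v i)) :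
    ∃ E : IntermediateField K L, FiniteDimensional K E ∧
      ∃ (w' : Fin r → ι → E) (u' : Fin r → κ → E) (v' : Fin r → μ → E),
        (fun a b c => algebraMap K E (x a b c)) = ∑ i, triad (w' i) (u' i) (v' i) := by
  classical
  -- the finite set of all coordinates of the decomposition
  let S : Set L := Set.range (fun p : Fin r × ι => w p.1 p.2) ∪
    (Set.range (fun p : Fin r × κ => u p.1 p.2) ∪ Set.range (fun p : Fin r × μ => v p.1 p.2))
  have hSfin : S.Finite :=
    (Set.finite_range _).union ((Set.finite_range _).union (Set.finite_range _))
  haveI : Finite S := hSfin.to_subtype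
  let E : IntermediateField K L := IntermediateField.adjoin K S
  have hE : FiniteDimensional K E :=
    IntermediateField.finiteDimensional_adjoin fun y _ =>
      (Algebra.IsAlgebraic.isAlgebraic (R := K) y).isIntegral
  have hw : ∀ i a, w i a ∈ E := fun i a =>
    IntermediateField.subset_adjoin K S (Or.inl ⟨(i, a), rfl⟩)
  have hu : ∀ i b, u i b ∈ E := fun i b =>
    IntermediateField.subset_adjoin K S (Or.inr (Or.inl ⟨(i, b), rfl⟩))
  have hv : ∀ i c, v i c ∈ E := fun i c =>
    IntermediateField.subset_adjoin K S (Or.inr (Or.inr ⟨(i, c), rfl⟩))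
  refine ⟨E, hE, fun i a => ⟨w i a, hw i a⟩, fun i b => ⟨u i b, hu i b⟩,
    fun i c => ⟨v i c, hv i c⟩, ?_⟩
  funext a b c
  apply (algebraMap E L).injective
  have hx : algebraMap K L (x a b c) = ∑ i, w i a * u i b * v i c := by
    rw [← sum_triad_apply, ← h]
  rw [← IsScalarTower.algebraMap_apply, hx, sum_triad_apply, map_sum]
  refine Finset.sum_congr rfl fun i _ => ?_
  rw [map_mul, map_mul]
  rfl

/-- **Decompositions over `K` of a fixed power approach the asymptotic rank over an algebraic
extension** (BCS Prop. (15.17)(1) with the limit argument of Cor. (15.18), for `R̃` of a tensor):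
for every `δ > 0` there is `m ≥ 1` with `R_K(t^{⊗m}) < (R̃_L(t_L) + δ)^m`. Proof: an
`L`-decomposition of `t_L^{⊗m₀}` of length `R < (R̃_L + δ/2)^{m₀}` lives in a finite subextension
`E` of degree `d` (`exists_finiteDimensional_decomposition`); its `j`-th Kronecker power has
length `R^j` over `E` and descends to `K` with length `≤ d³ R^j`
(`tensorRank_le_of_eq_sum_algebraMap`); take `j` with `d³ < ((R̃+δ)/(R̃+δ/2))^{m₀ j}`, `m = m₀ j`.
[cite: BurgisserClausenShokrollahi1997, Prop. 15.17] -/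
theorem exists_tensorRank_kroneckerPow_lt_of_isAlgebraic (t : ι → κ → μ → K) {δ : ℝ}
    (hδ : 0 < δ) :
    ∃ m : ℕ, 1 ≤ m ∧ (tensorRank (kroneckerPow t m) : ℝ) <
      (asymptoticRank (fun a b c => algebraMap K L (t a b c)) + δ) ^ m := by
  classical
  set tL : ι → κ → μ → L := fun a b c => algebraMap K L (t a b c)
  set ρ := asymptoticRank tL
  have hρ : 0 ≤ ρ := asymptoticRank_nonneg _
  -- a decomposition over `L` of a fixed power
  obtain ⟨m₀, hm₀, hR⟩ := exists_tensorRank_kroneckerPow_lt tL (half_pos hδ)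
  set R := tensorRank (kroneckerPow tL m₀)
  obtain ⟨w, u, v, hdec⟩ := exists_triad_decomposition_tensorRank (kroneckerPow tL m₀)
  have hdec' : (fun a b c => algebraMap K L (kroneckerPow t m₀ a b c)) =
      ∑ i, triad (w i) (u i) (v i) :=
    (kroneckerPow_map (algebraMap K L) t m₀).symm.trans hdec
  -- descend to a finite subextension `E`
  obtain ⟨E, hEfd, w', u', v', hE⟩ :=
    exists_finiteDimensional_decomposition (kroneckerPow t m₀) w u v hdec'
  haveI : FiniteDimensional K E := hEfd
  set d := Module.finrank K E
  -- Kronecker powers over `E`: `R_E((t^{⊗m₀})_E^{⊗j}) ≤ R^j`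
  set sE : (Fin m₀ → ι) → (Fin m₀ → κ) → (Fin m₀ → μ) → E :=
    fun a b c => algebraMap K E (kroneckerPow t m₀ a b c)
  have hsE : tensorRank sE ≤ R := tensorRank_le_of_eq_sum w' u' v' hE
  have hpowE : ∀ j, tensorRank (kroneckerPow sE j) ≤ R ^ j := fun j =>
    (tensorRank_kroneckerPow_le sE j).trans (Nat.pow_le_pow_left hsE j)
  -- descent: `R_K((t^{⊗m₀})^{⊗j}) ≤ R^j d³`
  have hdesc : ∀ j, tensorRank (kroneckerPow (kroneckerPow t m₀) j) ≤ R ^ j * d ^ 3 := by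
    intro j
    obtain ⟨wj, uj, vj, hj⟩ := exists_triad_decomposition_tensorRank (kroneckerPow sE j)
    have hmap : (fun a b c => algebraMap K E (kroneckerPow (kroneckerPow t m₀) j a b c)) =
        kroneckerPow sE j := by
      funext a b c
      simp only [kroneckerPow_apply, sE, map_prod]
    exact (tensorRank_le_of_eq_sum_algebraMap _ wj uj vj (hmap.trans hj)).trans
      (Nat.mul_le_mul_right _ (hpowE j))
  -- choice of `j`
  have hq : 1 < (ρ + δ) / (ρ + δ / 2) := by
    rw [one_lt_div (by linarith)]; linarith
  have hqm : 1 < ((ρ + δ) / (ρ + δ / 2)) ^ m₀ := one_lt_pow₀ hq (by omega)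
  obtain ⟨j, hj1, hj⟩ := exists_lt_pow_of_one_lt (D := (d : ℝ) ^ 3) hqm
  refine ⟨m₀ * j, Nat.one_le_iff_ne_zero.2 (Nat.mul_ne_zero (by omega) (by omega)), ?_⟩
  have h1 : tensorRank (kroneckerPow t (m₀ * j)) ≤ R ^ j * d ^ 3 := by
    rw [mul_comm m₀ j]
    exact (tensorRank_kroneckerPow_mul_le_pow_pow t j m₀).trans (hdesc j)
  have hRle : (R : ℝ) ≤ (ρ + δ / 2) ^ m₀ := hR.le
  have hhalf : 0 < ρ + δ / 2 := by linarith
  calc (tensorRank (kroneckerPow t (m₀ * j)) : ℝ) ≤ (R : ℝ) ^ j * (d : ℝ) ^ 3 := by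
        exact_mod_cast h1
    _ ≤ ((ρ + δ / 2) ^ m₀) ^ j * (d : ℝ) ^ 3 := by gcongr
    _ < ((ρ + δ / 2) ^ m₀) ^ j * (((ρ + δ) / (ρ + δ / 2)) ^ m₀) ^ j := by gcongr
    _ = (ρ + δ) ^ (m₀ * j) := by
        rw [← mul_pow, ← mul_pow, mul_div_cancel₀ _ hhalf.ne', pow_mul]

/-- **The asymptotic rank is invariant under algebraic field extension** (BCS Prop. (15.17)(1) and
Cor. (15.18), Schönhage, for `R̃` of a tensor in place of `ω`; the reduction "we may assume `𝔽` is
algebraically closed" of Alman–Li 2026, Cor. 4.1): `R̃_L(t_L) = R̃_K(t)` for `L/K` algebraic.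
[cite: BurgisserClausenShokrollahi1997, Prop. 15.17] -/
theorem asymptoticRank_algebraMap_of_isAlgebraic (t : ι → κ → μ → K) :
    asymptoticRank (fun a b c => algebraMap K L (t a b c)) = asymptoticRank t := by
  refine le_antisymm (asymptoticRank_map_le (algebraMap K L) t) ?_
  -- `R̃_K ≤ R̃_L + δ` for every `δ > 0`
  refine le_of_forall_pos_lt_add fun δ hδ => ?_
  obtain ⟨m, hm, hlt⟩ := exists_tensorRank_kroneckerPow_lt_of_isAlgebraic (L := L) t hδ
  have hρδ : 0 ≤ asymptoticRank (fun a b c => algebraMap K L (t a b c)) + δ := by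
    linarith [asymptoticRank_nonneg (fun a b c => algebraMap K L (t a b c))]
  calc asymptoticRank t
      ≤ (tensorRank (kroneckerPow t m) : ℝ) ^ ((m : ℝ)⁻¹) :=
        Literature.Barriers.MatrixMultiplication.asymptoticRank_le_rpow t (by omega)
    _ < ((asymptoticRank (fun a b c => algebraMap K L (t a b c)) + δ) ^ m) ^ ((m : ℝ)⁻¹) :=
        Real.rpow_lt_rpow (Nat.cast_nonneg _) hlt (by positivity)
    _ = asymptoticRank (fun a b c => algebraMap K L (t a b c)) + δ := by
        rw [← Real.rpow_natCast, ← Real.rpow_mul hρδ, mul_inv_cancel₀ (by positivity),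
          Real.rpow_one]

/-- In particular for the algebraic closure: `R̃_K(t) = R̃_{K̄}(t_{K̄})`.
[cite: BurgisserClausenShokrollahi1997, Prop. 15.17] -/
theorem asymptoticRank_algebraicClosure (t : ι → κ → μ → K) :
    asymptoticRank (fun a b c => algebraMap K (AlgebraicClosure K) (t a b c)) = asymptoticRank t :=
  asymptoticRank_algebraMap_of_isAlgebraic t

end Algebraic

end Literature.Computability.AlgebraicComplexity

end
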